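import Summits.ResolutionOfSingularities.ResolutionOfSingularities.Theorems.EquisingularLiftEquisingularLiftNatOccursAsSingularLocus
import Literature.AlgebraicGeometry.Motives.ProjectiveSpaceDehomogenize
import Mathlib.RingTheory.MvPolynomial.Homogeneous
import HarnessLib

/-!
# [OURS · L1 W4.5(b)] H-SING: the generic form singular along `V(P)` has singular locus exactly `V(P)`
# — projective gluing of `occurs_as_singular_locus` (crux `EquisingularLiftNat`,
# stmt-ResolutionOfSingularities-20038; vendored input of the disprover object K5-BMY)

NOT a statement of any manuscript. Helper file of the chain res-L1-w45b. The object K5-BMY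
(res-L1-w45b-strat-1 NAMING 2026-08-27, director-resolution ruling (4): disprover target of record
for `EquisingularLiftNat` AS TYPED at `n = 5`) takes a smooth surface `S ⊂ ℙ⁵_k` and «`G` general in
`H⁰(𝓘_S²(d))`, `d ≫ 0`, `H := V(G)`, so `(Sing H)_red = S` exactly — the `n = 5` analogue of
`ordTwo_generic_package`». This file proves that clause for EVERY `n` and EVERY closed
`V(P) ⊂ ℙⁿ_k` given by finitely many non-zero forms, at the level of forms and standard charts
(the currency of `Literature.AlgebraicGeometry.Motives.ProjectiveSpace.dehomogenize`, i.e. of the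
chart algebras `(k[x]_{xᵢ})₀ ≅ k[y₁,…,yₙ]` of `ℙⁿ_k` and of the tree's `hypersurface F`).

**Setting.** `k` algebraically closed; `g : γ → k[x₀,…,xₙ]` finitely many forms, `g c` homogeneous
of degree `e c`, not all zero; `P = (g_c)_c` their ideal (so `V(P) = V₊(g) ⊂ ℙⁿ`); `d` with
`e c + e c' + 1 ≤ d` for all `c, c'` («`d ≫ 0`», explicit).

**The system.** The finitely many forms of degree `d`
`F_{(c,c'),(i,l)} = xᵢ^{d-e_c-e_{c'}-1} · x_l · g_c g_{c'} ∈ P²`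
(the projective `P²`-system; written inline, this file is definition-free). On the chart
`D₊(xᵢ) = Spec k[y]` (dehomogenisation `xᵢ := 1`) it contains the affine `𝔭ᵢ²`-system
`{q · 1, q · x_l/xᵢ}` of `occurs_as_singular_locus` (p500339), `𝔭ᵢ = P(xᵢ := 1)`, `q = (g_c g_{c'})(xᵢ := 1)`.

**What is proved.**
* `surjective_linCombQuotSq_of_comp_injective`, `surjective_linCombQuotSq_mul_of_notMem` —
  bookkeeping: tangent separation passes to super-families and survives multiplication by a
  function that is a unit at the point.
* `dehomogenize_linComb` — dehomogenisation commutes with taking the member `G_t = Σ tⱼ Fⱼ`.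
* `isGeneric_singular_iff_chart` — **one chart**: for generic `t`, on `D₊(xᵢ)` the function
  `G_t(xᵢ := 1)` is non-zero, lies in `𝔭ᵢ²`, and at every closed point `𝔪 ∋ G_t(xᵢ := 1)` the
  local ring `k[y]_𝔪 ⧸ (G_t(xᵢ := 1))` of `V(G_t)` is regular **iff** `𝔪 ⊉ 𝔭ᵢ` (Bertini OFF
  `V(𝔭ᵢ)` from p500339 for the super-family; Matsumura 14.2 on `V(𝔭ᵢ)`).
* `isGeneric_singular_iff` — **all charts at once** (one coefficient space; finite intersection of
  generic conditions), and `G_t ≠ 0`, `G_t` homogeneous of degree `d`, `G_t ∈ P²`.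
* `projective_occurs_as_singular_locus` — **H-SING, headline** (existential in the system): for
  `V(P) ⊂ ℙⁿ_k` cut out by finitely many non-zero forms and `d ≫ 0` there are forms `Fⱼ ∈ P²` of
  degree `d` whose GENERIC combination `G` is a non-zero form of degree `d` in `P²` such that on
  every standard chart the closed singular points of the hypersurface `V(G)` are exactly the closed
  points of `V(P)`; `exists_form_singularLocus_eq` — a witness `G` exists (`k` infinite).

NOT covered (said so): the scheme-level packaging (`hypersurface G`, `Sing` as a subset of `Proj`),
irreducibility of `G` for `d ≫ 0`, the order-2 / transversal-`A₁` clauses (affine versions: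
p500916, p502343). References: Hartshorne II Thm. 8.18 [Hartshorne1977]; Matsumura Thm. 14.2
[Matsumura1987].
-/

set_option linter.dupNamespace false -- mandated namespace `Summit.<Summit>.<Problem>` of this single-conjunct summit

noncomputable section

open IsLocalRing MvPolynomial

universe u v w


namespace Summit.ResolutionOfSingularities.ResolutionOfSingularities.Cruxes.EquisingularLiftNat.Sections

open Literature.AlgebraicGeometry.Resolution Literature.AlgebraicGeometry.Resolution.BertiniAffine
open Literature.AlgebraicGeometry.Motives

variable {k : Type u} [Field k]

/-! ## Bookkeeping on tangent separation -/

/-- **Tangent separation passes to super-families**: if the sub-family `u ∘ e` (`e` injective)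
already maps `t ↦ s_t mod 𝔪²` onto `A ⧸ 𝔪²`, so does `u` (extend the coefficient vector by zero).
[folklore] [OURS · L1 W4.5b] helper for H-SING. -/
theorem surjective_linCombQuotSq_of_comp_injective {A : Type u} [CommRing A] [Algebra k A]
    {ι : Type v} {ι' : Type w} [Fintype ι] [Fintype ι'] (e : ι' → ι) (he : Function.Injective e)
    (u : ι → A) (𝔪 : Ideal A)
    (h : Function.Surjective (linCombQuotSq (k := k) (u ∘ e) 𝔪)) :
    Function.Surjective (linCombQuotSq (k := k) u 𝔪) := by
  classical
  intro y
  obtain ⟨t', ht'⟩ := h y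
  refine ⟨Function.extend e t' 0, ?_⟩
  have hlin : linComb u (Function.extend e t' 0) = linComb (u ∘ e) t' := by
    unfold linComb
    rw [← Finset.sum_subset (Finset.subset_univ (Finset.univ.image e)),
      Finset.sum_image fun a _ b _ hab => he hab]
    · refine Finset.sum_congr rfl fun j' _ => ?_
      rw [he.extend_apply, Function.comp_apply]
    · intro j _ hj
      have hj' : ∀ a, e a ≠ j := fun a ha =>
        hj (Finset.mem_image.mpr ⟨a, Finset.mem_univ _, ha⟩)
      rw [Function.extend_apply' _ _ _ (fun ⟨a, ha⟩ => hj' a ha), Pi.zero_apply, zero_smul]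
  rw [linCombQuotSq_apply, hlin, ← linCombQuotSq_apply, ht']

/-- **Tangent separation survives multiplication by a local unit**: if `t ↦ Σ tₗ vₗ mod 𝔪²` is
onto and `q ∉ 𝔪` (`𝔪` maximal), then `t ↦ Σ tₗ (vₗ q) mod 𝔪²` is onto (`q` is a unit modulo `𝔪²`).
[folklore] [OURS · L1 W4.5b] helper for H-SING. -/
theorem surjective_linCombQuotSq_mul_of_notMem {A : Type u} [CommRing A] [Algebra k A]
    {ι : Type v} [Fintype ι] (v : ι → A) (𝔪 : Ideal A) [𝔪.IsMaximal] {q : A} (hq : q ∉ 𝔪)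
    (hv : Function.Surjective (linCombQuotSq (k := k) v 𝔪)) :
    Function.Surjective (linCombQuotSq (k := k) (fun l => v l * q) 𝔪) := by
  have hunit : IsUnit (Ideal.Quotient.mk (𝔪 ^ 2) q) :=
    (Ideal.Quotient.isUnit_mk_pow_iff_notMem 𝔪 two_ne_zero).2 hq
  obtain ⟨b, hb⟩ := hunit.exists_right_inv
  intro y
  obtain ⟨t, ht⟩ := hv (b * y)
  refine ⟨t, ?_⟩
  have hlin : linComb (fun l => v l * q) t = linComb v t * q := by
    simp only [linComb, Finset.sum_mul, smul_mul_assoc]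
  rw [linCombQuotSq_apply, hlin, map_mul, ← linCombQuotSq_apply, ht, mul_comm, ← mul_assoc, hb,
    one_mul]

/-- **Dehomogenisation commutes with forming the member `G_t = Σ tⱼ Fⱼ`** (it is `k`-linear).
[folklore] [OURS · L1 W4.5b] helper for H-SING. -/
theorem dehomogenize_linComb {n : ℕ} {ι : Type v} [Fintype ι] (i : Fin (n + 1))
    (F : ι → MvPolynomial (Fin (n + 1)) k) (t : ι → k) :
    ProjectiveSpace.dehomogenize k i (linComb F t) =
      linComb (fun j => ProjectiveSpace.dehomogenize k i (F j)) t := by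
  simp only [linComb, map_sum, map_smul]

/-- A combination of members of an ideal lies in the ideal. [folklore]
[OURS · L1 W4.5b] helper for H-SING. -/
theorem linComb_mem_ideal {A : Type u} [CommRing A] [Algebra k A] {ι : Type v} [Fintype ι]
    {u : ι → A} {I : Ideal A} (hu : ∀ j, u j ∈ I) (t : ι → k) : linComb u t ∈ I :=
  Ideal.sum_mem _ fun j _ => by rw [Algebra.smul_def]; exact Ideal.mul_mem_left _ _ (hu j)

/-- A combination of forms of degree `d` is a form of degree `d`. [folklore]
[OURS · L1 W4.5b] helper for H-SING. -/
theorem isHomogeneous_linComb {m : ℕ} {ι : Type v} [Fintype ι] {F : ι → MvPolynomial (Fin m) k}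
    {d : ℕ} (hF : ∀ j, (F j).IsHomogeneous d) (t : ι → k) : (linComb F t).IsHomogeneous d := by
  refine IsHomogeneous.sum _ _ _ fun j _ => ?_
  rw [smul_eq_C_mul]
  simpa using (isHomogeneous_C (Fin m) (t j)).mul (hF j)

/-- **A non-zero form stays non-zero on every standard chart** (dehomogenisation is injective on
forms of a fixed degree, tree `ProjectiveSpace.eq_of_dehomogenize_eq`). [folklore]
[OURS · L1 W4.5b] helper for H-SING. -/
theorem dehomogenize_ne_zero {n : ℕ} (i : Fin (n + 1)) {G : MvPolynomial (Fin (n + 1)) k} {d : ℕ}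
    (hG : G.IsHomogeneous d) (h0 : G ≠ 0) : ProjectiveSpace.dehomogenize k i G ≠ 0 := fun h =>
  h0 (ProjectiveSpace.eq_of_dehomogenize_eq i hG (isHomogeneous_zero _ _ d) (by rw [h, map_zero]))

/-! ## The projective `P²`-system and its charts -/

section System

variable {n : ℕ} {γ : Type v} [Fintype γ]
  (g : γ → MvPolynomial (Fin (n + 1)) k) (e : γ → ℕ) (d : ℕ)

omit [Fintype γ] in
/-- The members `xᵢ^{d-e_c-e_{c'}-1} · x_l · g_c g_{c'}` of the projective `P²`-system are forms of
degree `d` (for `e_c + e_{c'} + 1 ≤ d`). [folklore] [OURS · L1 W4.5b] helper for H-SING. -/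
theorem isHomogeneous_sqSysMember (hg : ∀ c, (g c).IsHomogeneous (e c))
    (hd : ∀ c c', e c + e c' + 1 ≤ d) (j : (γ × γ) × (Fin (n + 1) × Fin (n + 1))) :
    (X j.2.1 ^ (d - (e j.1.1 + e j.1.2 + 1)) * X j.2.2 * (g j.1.1 * g j.1.2) :
      MvPolynomial (Fin (n + 1)) k).IsHomogeneous d := by
  have h1 : (X j.2.1 ^ (d - (e j.1.1 + e j.1.2 + 1)) : MvPolynomial (Fin (n + 1)) k).IsHomogeneous
      (1 * (d - (e j.1.1 + e j.1.2 + 1))) := (isHomogeneous_X k j.2.1).pow _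
  have h := (h1.mul (isHomogeneous_X k j.2.2)).mul ((hg j.1.1).mul (hg j.1.2))
  have hdeg : 1 * (d - (e j.1.1 + e j.1.2 + 1)) + 1 + (e j.1.1 + e j.1.2) = d := by
    have := hd j.1.1 j.1.2
    omega
  rwa [hdeg] at h

omit [Fintype γ] in
/-- The members of the projective `P²`-system lie in `P²`, `P = (g_c)_c`. [folklore]
[OURS · L1 W4.5b] helper for H-SING. -/
theorem sqSysMember_mem (j : (γ × γ) × (Fin (n + 1) × Fin (n + 1))) :
    (X j.2.1 ^ (d - (e j.1.1 + e j.1.2 + 1)) * X j.2.2 * (g j.1.1 * g j.1.2) :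
      MvPolynomial (Fin (n + 1)) k) ∈ Ideal.span (Set.range g) ^ 2 := by
  rw [pow_two]
  exact Ideal.mul_mem_left _ _ (Ideal.mul_mem_mul (Ideal.subset_span ⟨j.1.1, rfl⟩)
    (Ideal.subset_span ⟨j.1.2, rfl⟩))

omit [Fintype γ] in
/-- **The chart of `P` on `D₊(xᵢ)`**: `P(xᵢ := 1)` is generated by the dehomogenised generators.
[folklore] [OURS · L1 W4.5b] helper for H-SING. -/
theorem map_dehomogenize_span (i : Fin (n + 1)) :
    (Ideal.span (Set.range g)).map (ProjectiveSpace.dehomogenize k i) =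
      Ideal.span (Set.range fun c => ProjectiveSpace.dehomogenize k i (g c)) := by
  rw [Ideal.map_span, ← Set.range_comp]
  rfl

/-- **H-SING on one chart.** `k` algebraically closed, `g_c` forms of degrees `e_c`, not all zero,
`P = (g_c)`, `e_c + e_{c'} + 1 ≤ d`. For GENERIC coefficient vectors `t` of the projective
`P²`-system, on the chart `D₊(xᵢ) = Spec k[y₁,…,yₙ]` (`xᵢ := 1`): the dehomogenised member
`f = G_t(xᵢ := 1)` is non-zero, lies in `𝔭ᵢ²` (`𝔭ᵢ = P(xᵢ := 1)`), and for every closed point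
`𝔪 ∋ f` the local ring `k[y]_𝔪 ⧸ (f)` of the hypersurface `V(G_t)` is regular **iff** `𝔪 ⊉ 𝔭ᵢ`.
Proof: the chart family `j ↦ F_j(xᵢ := 1)` contains the affine `𝔭ᵢ²`-system `l ↦ (x_l/xᵢ) · q`,
`q = g_c²(xᵢ := 1)` a unit at `𝔪 ⊉ 𝔭ᵢ`, which separates tangent vectors
(`BertiniAffine.surjective_linCombQuotSq_of_adjoin_eq_top`), so Bertini off `V(𝔭ᵢ)`
(`isGeneric_isRegularLocalRing_quotient_linComb_off`, p500339) gives the regular half; the singular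
half is Matsumura 14.2 (`not_isRegularLocalRing_quotient_of_mem_sq`); non-vanishing is
`isGeneric_linComb_ne_zero` with the member `g_{c₀}²`. [cite: Hartshorne1977, II Thm. 8.18]
[cite: Matsumura1987, Thm. 14.2] [OURS · L1 W4.5b] helper H-SING toward the K5-BMY object of crux
`EquisingularLiftNat` (stmt-ResolutionOfSingularities-20038); NOT a statement of the manuscript. -/
theorem isGeneric_singular_iff_chart [IsAlgClosed k] (hg : ∀ c, (g c).IsHomogeneous (e c))
    (hne : ∃ c, g c ≠ 0) (i : Fin (n + 1)) :
    IsGeneric fun t : (γ × γ) × (Fin (n + 1) × Fin (n + 1)) → k =>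
      ProjectiveSpace.dehomogenize k i (linComb (fun j : (γ × γ) × (Fin (n + 1) × Fin (n + 1)) =>
          X j.2.1 ^ (d - (e j.1.1 + e j.1.2 + 1)) * X j.2.2 * (g j.1.1 * g j.1.2)) t) ≠ 0 ∧
      ProjectiveSpace.dehomogenize k i (linComb (fun j : (γ × γ) × (Fin (n + 1) × Fin (n + 1)) =>
          X j.2.1 ^ (d - (e j.1.1 + e j.1.2 + 1)) * X j.2.2 * (g j.1.1 * g j.1.2)) t) ∈
        (Ideal.span (Set.range g)).map (ProjectiveSpace.dehomogenize k i) ^ 2 ∧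
      ∀ (𝔪 : Ideal (MvPolynomial (Fin n) k)) [𝔪.IsMaximal],
        ProjectiveSpace.dehomogenize k i (linComb (fun j : (γ × γ) × (Fin (n + 1) × Fin (n + 1)) =>
          X j.2.1 ^ (d - (e j.1.1 + e j.1.2 + 1)) * X j.2.2 * (g j.1.1 * g j.1.2)) t) ∈ 𝔪 →
        (IsRegularLocalRing (Localization.AtPrime 𝔪 ⧸ Ideal.span {algebraMap _
            (Localization.AtPrime 𝔪) (ProjectiveSpace.dehomogenize k i (linComb
              (fun j : (γ × γ) × (Fin (n + 1) × Fin (n + 1)) =>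
                X j.2.1 ^ (d - (e j.1.1 + e j.1.2 + 1)) * X j.2.2 * (g j.1.1 * g j.1.2)) t))}) ↔
          ¬ (Ideal.span (Set.range g)).map (ProjectiveSpace.dehomogenize k i) ≤ 𝔪) := by
  classical
  -- notation: the chart algebra `A = k[y]`, dehomogenisation `φ`, the chart family `u`, `𝔭ᵢ`
  set φ := ProjectiveSpace.dehomogenize k i with hφ
  set Fam : (γ × γ) × (Fin (n + 1) × Fin (n + 1)) → MvPolynomial (Fin (n + 1)) k :=
    fun j => X j.2.1 ^ (d - (e j.1.1 + e j.1.2 + 1)) * X j.2.2 * (g j.1.1 * g j.1.2) with hFam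
  set u : (γ × γ) × (Fin (n + 1) × Fin (n + 1)) → MvPolynomial (Fin n) k := fun j => φ (Fam j)
    with hu
  set 𝔭 : Ideal (MvPolynomial (Fin n) k) := (Ideal.span (Set.range g)).map φ with h𝔭
  have hlin : ∀ t, φ (linComb Fam t) = linComb u t := fun t => dehomogenize_linComb i Fam t
  -- every member lies in `𝔭ᵢ²`
  have hu2 : ∀ j, u j ∈ 𝔭 ^ 2 := fun j => by
    rw [h𝔭, ← Ideal.map_pow]
    exact Ideal.mem_map_of_mem _ (sqSysMember_mem g e d j)
  -- the chart coordinates `x_l/xᵢ` generate `k[y]` and contain `1`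
  set v : Fin (n + 1) → MvPolynomial (Fin n) k := fun l => φ (X l) with hv
  have hvi : v i = 1 := ProjectiveSpace.dehomogenize_X_self k i
  have hgen : Algebra.adjoin k (Set.range v) = ⊤ := by
    refine top_le_iff.1 ?_
    rw [← MvPolynomial.adjoin_range_X]
    refine Algebra.adjoin_mono ?_
    rintro _ ⟨j, rfl⟩
    exact ⟨i.succAbove j, ProjectiveSpace.dehomogenize_X_succAbove k i j⟩
  -- tangent separation off `V(𝔭ᵢ)`
  have hoff : ∀ 𝔪 : Ideal (MvPolynomial (Fin n) k), 𝔪.IsMaximal → ¬ 𝔭 ≤ 𝔪 →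
      Function.Surjective (linCombQuotSq (k := k) u 𝔪) := by
    intro 𝔪 h𝔪 hp𝔪
    -- a generator `g_c` with `g_c(xᵢ := 1) ∉ 𝔪`
    have hex : ∃ c, φ (g c) ∉ 𝔪 := by
      by_contra hcon
      push Not at hcon
      apply hp𝔪
      rw [h𝔭, map_dehomogenize_span]
      refine Ideal.span_le.2 ?_
      rintro _ ⟨c, rfl⟩
      exact hcon c
    obtain ⟨c, hc⟩ := hex
    have hq : φ (g c * g c) ∉ 𝔪 := by
      rw [map_mul]
      exact fun h => (h𝔪.isPrime.mem_or_mem h).elim hc hc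
    -- the sub-family `l ↦ (x_l/xᵢ) · q`
    have hsub : Function.Surjective (linCombQuotSq (k := k) (fun l => v l * φ (g c * g c)) 𝔪) :=
      surjective_linCombQuotSq_mul_of_notMem v 𝔪 hq
        (surjective_linCombQuotSq_of_adjoin_eq_top v hgen (j₀ := i) hvi 𝔪)
    let emb : Fin (n + 1) → (γ × γ) × (Fin (n + 1) × Fin (n + 1)) := fun l => ((c, c), (i, l))
    have hemb : Function.Injective emb := fun l l' h => by
      simpa [emb] using h
    have hcomp : u ∘ emb = fun l => v l * φ (g c * g c) := by
      funext l
      simp only [Function.comp_apply, hu, hFam, emb, map_mul, map_pow, hv, hφ,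
        ProjectiveSpace.dehomogenize_X_self, one_pow, one_mul]
    exact surjective_linCombQuotSq_of_comp_injective emb hemb u 𝔪 (hcomp ▸ hsub)
  -- Bertini off `V(𝔭ᵢ)`
  have hA := isGeneric_isRegularLocalRing_quotient_linComb_off (k := k) 𝔭 u hoff
  -- non-vanishing: the member `g_{c₀}²(xᵢ := 1) ≠ 0`
  obtain ⟨c₀, hc₀⟩ := hne
  have hq₀ : φ (g c₀) ≠ 0 := dehomogenize_ne_zero i (hg c₀) hc₀
  have hB : IsGeneric fun t : (γ × γ) × (Fin (n + 1) × Fin (n + 1)) → k => linComb u t ≠ 0 := by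
    refine isGeneric_linComb_ne_zero (k := k) u ⟨((c₀, c₀), (i, i)), ?_⟩
    simp only [hu, hFam, map_mul, map_pow, hφ, ProjectiveSpace.dehomogenize_X_self, one_pow,
      one_mul]
    exact mul_ne_zero hq₀ hq₀
  refine (hA.and hB).mono fun t ht => ?_
  rw [hlin t]
  refine ⟨ht.2, linComb_mem_ideal hu2 t, fun 𝔪 h𝔪 hst => ⟨fun hreg hp𝔪 => ?_, fun hp𝔪 => ?_⟩⟩
  · -- regular at `𝔪` forces `𝔪 ⊉ 𝔭ᵢ`
    have hs2 : linComb u t ∈ 𝔪 ^ 2 := Ideal.pow_right_mono hp𝔪 2 (linComb_mem_ideal hu2 t)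
    exact not_isRegularLocalRing_quotient_of_mem_sq 𝔪 ht.2 hs2 hreg
  · exact ht.1 𝔪 hp𝔪 hst

/-- **H-SING, all charts at once.** Under the hypotheses of `isGeneric_singular_iff_chart`, for
GENERIC `t` (ONE coefficient space for the `n + 1` charts; a finite intersection of generic
conditions, `IsGeneric.forall_fintype`): the member `G_t` of the projective `P²`-system is a
NON-ZERO form of degree `d` lying in `P²`, and on EVERY chart `D₊(xᵢ)` the conclusion of
`isGeneric_singular_iff_chart` holds — the closed singular points of `V(G_t) ⊂ ℙⁿ_k` are exactly the
closed points of `V(P)`. [cite: Hartshorne1977, II Thm. 8.18] [cite: Matsumura1987, Thm. 14.2]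
[OURS · L1 W4.5b] helper H-SING (K5-BMY input) for crux `EquisingularLiftNat`
(stmt-ResolutionOfSingularities-20038); NOT a statement of the manuscript. -/
theorem isGeneric_singular_iff [IsAlgClosed k] (hg : ∀ c, (g c).IsHomogeneous (e c))
    (hne : ∃ c, g c ≠ 0) (hd : ∀ c c', e c + e c' + 1 ≤ d) :
    IsGeneric fun t : (γ × γ) × (Fin (n + 1) × Fin (n + 1)) → k =>
      linComb (fun j : (γ × γ) × (Fin (n + 1) × Fin (n + 1)) =>
          X j.2.1 ^ (d - (e j.1.1 + e j.1.2 + 1)) * X j.2.2 * (g j.1.1 * g j.1.2)) t ≠ 0 ∧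
      (linComb (fun j : (γ × γ) × (Fin (n + 1) × Fin (n + 1)) =>
          X j.2.1 ^ (d - (e j.1.1 + e j.1.2 + 1)) * X j.2.2 * (g j.1.1 * g j.1.2)) t).IsHomogeneous d ∧
      linComb (fun j : (γ × γ) × (Fin (n + 1) × Fin (n + 1)) =>
          X j.2.1 ^ (d - (e j.1.1 + e j.1.2 + 1)) * X j.2.2 * (g j.1.1 * g j.1.2)) t ∈
        Ideal.span (Set.range g) ^ 2 ∧
      ∀ i : Fin (n + 1),
        ProjectiveSpace.dehomogenize k i (linComb (fun j : (γ × γ) × (Fin (n + 1) × Fin (n + 1)) =>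
            X j.2.1 ^ (d - (e j.1.1 + e j.1.2 + 1)) * X j.2.2 * (g j.1.1 * g j.1.2)) t) ≠ 0 ∧
        ProjectiveSpace.dehomogenize k i (linComb (fun j : (γ × γ) × (Fin (n + 1) × Fin (n + 1)) =>
            X j.2.1 ^ (d - (e j.1.1 + e j.1.2 + 1)) * X j.2.2 * (g j.1.1 * g j.1.2)) t) ∈
          (Ideal.span (Set.range g)).map (ProjectiveSpace.dehomogenize k i) ^ 2 ∧
        ∀ (𝔪 : Ideal (MvPolynomial (Fin n) k)) [𝔪.IsMaximal],
          ProjectiveSpace.dehomogenize k i (linComb (fun j : (γ × γ) × (Fin (n + 1) × Fin (n + 1)) =>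
            X j.2.1 ^ (d - (e j.1.1 + e j.1.2 + 1)) * X j.2.2 * (g j.1.1 * g j.1.2)) t) ∈ 𝔪 →
          (IsRegularLocalRing (Localization.AtPrime 𝔪 ⧸ Ideal.span {algebraMap _
              (Localization.AtPrime 𝔪) (ProjectiveSpace.dehomogenize k i (linComb
                (fun j : (γ × γ) × (Fin (n + 1) × Fin (n + 1)) =>
                  X j.2.1 ^ (d - (e j.1.1 + e j.1.2 + 1)) * X j.2.2 * (g j.1.1 * g j.1.2)) t))}) ↔
            ¬ (Ideal.span (Set.range g)).map (ProjectiveSpace.dehomogenize k i) ≤ 𝔪) := by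
  have hall := IsGeneric.forall_fintype fun i : Fin (n + 1) =>
    isGeneric_singular_iff_chart (k := k) g e d hg hne i
  refine hall.mono fun t ht => ⟨?_, ?_, ?_, ht⟩
  · intro h0
    exact (ht 0).1 (by rw [h0, map_zero])
  · exact isHomogeneous_linComb (isHomogeneous_sqSysMember g e d hg hd) t
  · exact linComb_mem_ideal (sqSysMember_mem g e d) t

end System

/-! ## H-SING: headline and witness -/

/-- **H-SING `projective_occurs_as_singular_locus` — the generic form singular along `V(P)` has
closed singular locus exactly the closed points of `V(P)`.** Let `k` be algebraically closed,
`g_c ∈ k[x₀,…,xₙ]` finitely many forms of degrees `e_c`, not all zero, `P = (g_c)` (so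
`V(P) = V₊(g) ⊂ ℙⁿ_k` is any closed set given by equations — no smoothness, primality or dimension
hypothesis), and `d` with `e_c + e_{c'} + 1 ≤ d` («`d ≫ 0`»). Then there are finitely many forms
`Fⱼ ∈ P²` of degree `d` (the projective `P²`-system, the degree-`d` chart of `H⁰(𝓘_{V(P)}²(d))`
used by the K5-BMY object) such that every member `G_t = Σ tⱼ Fⱼ` is a form of degree `d` in `P²`,
and for GENERIC `t` (`IsGeneric`: off the zeros of a non-zero polynomial in the `tⱼ`; non-vacuous,
`k` infinite): `G_t ≠ 0` and on EVERY standard chart `D₊(xᵢ) = Spec k[y₁,…,yₙ]` (`xᵢ := 1`,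
`Motives.ProjectiveSpace.dehomogenize`) the function `G_t(xᵢ := 1)` is non-zero, lies in
`P(xᵢ := 1)²`, and at every closed point `𝔪` of `V(G_t) ∩ D₊(xᵢ)` the local ring `k[y]_𝔪 ⧸ (G_t(xᵢ := 1))`
of the hypersurface `V(G_t)` is regular **iff** `𝔪 ⊉ P(xᵢ := 1)` — the closed singular points of
`V(G_t) ⊂ ℙⁿ_k` are exactly the closed points of `V(P)`. Dimension-free projective gluing of
`occurs_as_singular_locus` (p500339). [cite: Hartshorne1977, II Thm. 8.18]
[cite: Matsumura1987, Thm. 14.2] [OURS · L1 W4.5b] helper H-SING = vendored input «(Sing V(G))_red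
= S exactly» of the disprover object K5-BMY for crux `EquisingularLiftNat`
(stmt-ResolutionOfSingularities-20038); NOT a statement of the manuscript. -/
theorem projective_occurs_as_singular_locus [IsAlgClosed k] {n : ℕ} {γ : Type v} [Fintype γ]
    (g : γ → MvPolynomial (Fin (n + 1)) k) (e : γ → ℕ) (hg : ∀ c, (g c).IsHomogeneous (e c))
    (hne : ∃ c, g c ≠ 0) (d : ℕ) (hd : ∀ c c', e c + e c' + 1 ≤ d) :
    ∃ (ι : Type v) (_ : Fintype ι) (F : ι → MvPolynomial (Fin (n + 1)) k),
      (∀ j, (F j).IsHomogeneous d) ∧ (∀ j, F j ∈ Ideal.span (Set.range g) ^ 2) ∧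
      (∀ t : ι → k, (linComb F t).IsHomogeneous d ∧ linComb F t ∈ Ideal.span (Set.range g) ^ 2) ∧
      IsGeneric fun t : ι → k =>
        linComb F t ≠ 0 ∧
        ∀ i : Fin (n + 1),
          ProjectiveSpace.dehomogenize k i (linComb F t) ≠ 0 ∧
          ProjectiveSpace.dehomogenize k i (linComb F t) ∈
            (Ideal.span (Set.range g)).map (ProjectiveSpace.dehomogenize k i) ^ 2 ∧
          ∀ (𝔪 : Ideal (MvPolynomial (Fin n) k)) [𝔪.IsMaximal],
            ProjectiveSpace.dehomogenize k i (linComb F t) ∈ 𝔪 →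
            (IsRegularLocalRing (Localization.AtPrime 𝔪 ⧸ Ideal.span {algebraMap _
                (Localization.AtPrime 𝔪) (ProjectiveSpace.dehomogenize k i (linComb F t))}) ↔
              ¬ (Ideal.span (Set.range g)).map (ProjectiveSpace.dehomogenize k i) ≤ 𝔪) := by
  refine ⟨(γ × γ) × (Fin (n + 1) × Fin (n + 1)), inferInstance,
    fun j => X j.2.1 ^ (d - (e j.1.1 + e j.1.2 + 1)) * X j.2.2 * (g j.1.1 * g j.1.2),
    isHomogeneous_sqSysMember g e d hg hd, sqSysMember_mem g e d,
    fun t => ⟨isHomogeneous_linComb (isHomogeneous_sqSysMember g e d hg hd) t,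
      linComb_mem_ideal (sqSysMember_mem g e d) t⟩, ?_⟩
  exact (isGeneric_singular_iff g e d hg hne hd).mono fun t ht => ⟨ht.1, ht.2.2.2⟩

/-- **Corollary (a witness form exists).** Under the hypotheses of
`projective_occurs_as_singular_locus` there is a NON-ZERO form `G ∈ P²` of degree `d` whose
hypersurface `V(G) ⊂ ℙⁿ_k` has, on every standard chart, closed singular points exactly the closed
points of `V(P)` (`k` is infinite; `IsGeneric.nonempty`). [OURS · L1 W4.5b] helper H-SING
(K5-BMY input) for crux `EquisingularLiftNat` (stmt-ResolutionOfSingularities-20038); NOT a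
statement of the manuscript. -/
theorem exists_form_singularLocus_eq [IsAlgClosed k] {n : ℕ} {γ : Type v} [Fintype γ]
    (g : γ → MvPolynomial (Fin (n + 1)) k) (e : γ → ℕ) (hg : ∀ c, (g c).IsHomogeneous (e c))
    (hne : ∃ c, g c ≠ 0) (d : ℕ) (hd : ∀ c c', e c + e c' + 1 ≤ d) :
    ∃ G : MvPolynomial (Fin (n + 1)) k, G ≠ 0 ∧ G.IsHomogeneous d ∧
      G ∈ Ideal.span (Set.range g) ^ 2 ∧
      ∀ i : Fin (n + 1),
        ProjectiveSpace.dehomogenize k i G ≠ 0 ∧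
        ProjectiveSpace.dehomogenize k i G ∈
          (Ideal.span (Set.range g)).map (ProjectiveSpace.dehomogenize k i) ^ 2 ∧
        ∀ (𝔪 : Ideal (MvPolynomial (Fin n) k)) [𝔪.IsMaximal],
          ProjectiveSpace.dehomogenize k i G ∈ 𝔪 →
          (IsRegularLocalRing (Localization.AtPrime 𝔪 ⧸ Ideal.span {algebraMap _
              (Localization.AtPrime 𝔪) (ProjectiveSpace.dehomogenize k i G)}) ↔
            ¬ (Ideal.span (Set.range g)).map (ProjectiveSpace.dehomogenize k i) ≤ 𝔪) := by
  obtain ⟨ι, hι, F, hFd, -, hall, hgen⟩ := projective_occurs_as_singular_locus g e hg hne d hd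
  haveI : Infinite k := IsAlgClosed.instInfinite
  obtain ⟨t, ht⟩ := hgen.nonempty
  exact ⟨linComb F t, ht.1, (hall t).1, (hall t).2, ht.2⟩

end Summit.ResolutionOfSingularities.ResolutionOfSingularities.Cruxes.EquisingularLiftNat.Sections

end
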